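import Summits.Langlands.Langlands.Statement
import Literature.NumberTheory.Automorphic.PotentialAutomorphyGL2OrdinaryWeightTwo
import Literature.FieldTheory.AlgClosed.PadicAlgClEquivComplex
import HarnessLib

/-!
# F3 `_special` — the floor `θ = 0` IS the family member (line `OrdinaryPotentialAutomorphyEveryWeight`, crux
# `ReciprocityUpToIrreducibility`, item stmt-Langlands-14328; G4 ladder-down generation 36)

Self-contained certificate (same declarations as §§1–4 of `Lines/OrdinaryPotentialAutomorphyEveryWeight.lean`):
* the graded family `OrdinaryPotentialAutomorphy : ℕ → Prop` of the HODGE–TATE-WEIGHT dial of Thorne's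
  residually-unrestricted ordinary potential modularity theorem for `GL₂` over totally real `F` (every `p`,
  no hypothesis on `ρ̄`) — `θ = 0`: weight `k = 2` (Thorne 2026 Thm. B, the tree's named fact); `θ ≥ 1`: every
  weight `k ≥ 2` (THE RUNG `OrdinaryPotentialAutomorphyEveryWeight = OrdinaryPotentialAutomorphy 1`);
* `floor_zero : Thorne2026_potentialAutomorphy_GL2_potCrystallineOrdinary → OrdinaryPotentialAutomorphy 0` —
  PROVED, no `sorry`: the floor cell IS the tree's named fact (binders verbatim; the fact's extra
  `T.IsRegular` conjunct is dropped from the conclusion);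
* `mono : θ ≤ θ' → OrdinaryPotentialAutomorphy θ' → OrdinaryPotentialAutomorphy θ` (rung ⇒ floor cell,
  `floor_of_rung`); `rung_iff_family_one`, `family_succ_iff`.
Why the witness lies outside S's known regime and exercises the lever: it is the `θ = 0` member of the SAME
typed family whose `θ = 1` member is open; the floor is Thorne's depth-`C` theorem for RESIDUALLY REDUCIBLE
(and `p = 2`) `ρ` over arbitrary totally real `F` — a regime where clause (B) of S is known by no other
method (Skinner–Wiles 1999 p. 8: abelian `F(χ)` only; Pan 2022 / Zhang 2024–25: `F = ℚ` or abelian `F` with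
`p` split) — and the rung asks exactly that lever (depth-`C` approximation + depth-`C` ordinary lifting) to
move off Hodge–Tate weights `{0,1}`.
-/

noncomputable section

set_option linter.dupNamespace false

open scoped MatrixGroups Matrix NumberField Classical
open NumberField IsDedekindDomain Field Filter
open Literature.NumberTheory.Automorphic Literature.NumberTheory.GaloisRepresentations
open Literature.NumberTheory.PAdicHodge
open Summit.Langlands

namespace Summit.Langlands.Langlands.Cruxes.ReciprocityUpToIrreducibility.OrdinaryPotentialAutomorphyEveryWeight

/-! ## 1. The dial clause -/

/-- The **weight clause** of the dial (the ONE hypothesis that moves): `θ = 0` — the weight is `2`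
(Thorne 2026 Thm. B verbatim, the tree's fact); `θ ≥ 1` — any weight `k ≥ 2`. -/
def weightClause : ℕ → ℕ → Prop
  | 0, k => k = 2
  | _ + 1, k => 2 ≤ k

theorem weightClause_zero_iff (k : ℕ) : weightClause 0 k ↔ k = 2 := Iff.rfl

theorem weightClause_succ_iff (θ k : ℕ) : weightClause (θ + 1) k ↔ 2 ≤ k := Iff.rfl

/-- The clause only weakens as `θ` grows. -/
theorem weightClause_mono {θ θ' : ℕ} (hle : θ ≤ θ') {k : ℕ} (h : weightClause θ k) :
    weightClause θ' k := by
  cases θ' with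
  | zero =>
    have : θ = 0 := Nat.le_zero.mp hle
    subst this; exact h
  | succ j =>
    cases θ with
    | zero =>
      have hk : k = 2 := h
      show 2 ≤ k
      omega
    | succ i => exact h

/-! ## 2. The hypotheses, the conclusion, the family, the rung -/

/-- **Local hypothesis above `p`** (verbatim from the fact, with the weight `2` replaced by `k`): at every
`v ∣ p`, `ρ|Γ_{F_v}` is ORDINARY OF WEIGHT `k` (`ρ|I_v ∼ (θ₁ ∗ ; 0 θ₂)`, `θ₁^m = χ_p^{(k-1)m}`, `θ₂^m = 1`)
for some `m > 0`, de Rham for the PINNED Fontaine datum, and potentially crystalline (`N = 0`). -/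
def OrdinaryLocalHyp (F : Type) [Field F] [NumberField F] (p : ℕ) [Fact p.Prime]
    (ρ : FramedGaloisRep F (PadicAlgCl p) 2) (k : ℕ) : Prop :=
  ∀ (v : HeightOneSpectrum (𝓞 F)) (hv : ((p : ℕ) : 𝓞 F) ∈ v.asIdeal),
    ∃ m : ℕ, 0 < m ∧ FramedGaloisRep.IsOrdinaryOfWeightAt p ρ v k m ∧
      (fontainePstAdicCompletion v p hv).IsDeRhamFramed (ρ.toLocal v) ∧
      ∀ r, (fontainePstAdicCompletion v p hv).IsWeilDeligneOf (ρ.toLocal v) r → r.N = 0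

/-- **Conclusion shape** (verbatim from the fact, minus its `T.IsRegular` conjunct): `ρ` is POTENTIALLY
automorphic — a finite totally real `F'/F`, an `ι : ℚ̄_p ≃ ℂ`, and for every admissible level structure a
cuspidal `L`-algebraic `π` of `GL₂(𝔸_{F'})` with `char ρ|_{Γ_{F'}}(Frob_w) =` the Satake polynomial of `π_w`
at almost every `w` (the summit's normalisation `m = 1`). -/
def PotentiallyAutomorphicAE (F : Type) [Field F] [NumberField F] (p : ℕ) [Fact p.Prime]
    (ρ : FramedGaloisRep F (PadicAlgCl p) 2) : Prop :=
  ∃ (F' : Type) (_ : Field F') (_ : NumberField F') (_ : Algebra F F'),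
    IsTotallyReal F' ∧ ∃ ι : PadicAlgCl p ≃+* ℂ,
      ∀ hF' : isCompact_glFiniteIntegralLevel 2 F',
        ∃ π : CuspidalAutomorphicRepData 2 F' hF', π.1.IsLAlgebraic ∧
          SatakeFrobCompatibleAE ι π.1 (ρ.restrictField F')

/-- **The rung family** `E(θ)`: residually-unrestricted potential automorphy for `GL₂` over totally real
`F`, every prime `p`, for irreducible, a.e.-unramified, totally odd `ρ`, ordinary of weight `k` and
potentially crystalline above `p`, with `weightClause θ k`.
`θ = 0` IN THE TREE (Thorne 2026 Thm. B); `θ ≥ 1` OPEN.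
[cite: arXiv:2608.07186, Thm. B, Thm. 3.2, Thm. 4.1] [cite: SkinnerWiles1999, Thm. A/B §4.5, p. 8] -/
def OrdinaryPotentialAutomorphy (θ : ℕ) : Prop :=
  ∀ (F : Type) [Field F] [NumberField F], IsTotallyReal F →
    ∀ (p : ℕ) [Fact p.Prime] (ρ : FramedGaloisRep F (PadicAlgCl p) 2) (k : ℕ),
      weightClause θ k →
      ρ.toGaloisRep.IsIrreducible →
      (∀ᶠ v : HeightOneSpectrum (𝓞 F) in cofinite, ρ.IsUnramifiedAt v) →
      OrdinaryLocalHyp F p ρ k → ρ.IsOdd →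
      PotentiallyAutomorphicAE F p ρ

/-- **THE RUNG** (the filed statement): the family at `θ = 1` — Thorne's residually-unrestricted ordinary
potential automorphy over totally real fields in EVERY weight `k ≥ 2`.  OPEN. -/
def OrdinaryPotentialAutomorphyEveryWeight : Prop := OrdinaryPotentialAutomorphy 1

theorem rung_iff_family_one :
    OrdinaryPotentialAutomorphyEveryWeight ↔ OrdinaryPotentialAutomorphy 1 := Iff.rfl

/-! ## 3. (F2) Monotonicity: a higher cell implies every lower cell -/

theorem mono {θ θ' : ℕ} (hle : θ ≤ θ') (h : OrdinaryPotentialAutomorphy θ') :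
    OrdinaryPotentialAutomorphy θ := by
  intro F _ _ hF p _ ρ k hk
  exact h F hF p ρ k (weightClause_mono hle hk)

/-- Every cell `θ ≥ 1` is the rung (the dial is constant from `θ = 1` on). -/
theorem family_succ_iff (θ : ℕ) :
    OrdinaryPotentialAutomorphy (θ + 1) ↔ OrdinaryPotentialAutomorphyEveryWeight := by
  constructor
  · exact fun h => mono (by omega) h
  · intro h F _ _ hF p _ ρ k hk
    exact h F hF p ρ k hk

theorem floor_of_rung (h : OrdinaryPotentialAutomorphyEveryWeight) : OrdinaryPotentialAutomorphy 0 :=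
  mono (by omega) h

/-! ## 4. (F3) Floor: `θ = 0` is the tree's named fact (Thorne 2026, Theorem B) -/

/-- **FLOOR** `θ = 0` from the named fact (binders verbatim; the fact's conclusion also records a regular
infinity type, which the family's conclusion does not ask for). -/
theorem floor_zero (hT : Thorne2026_potentialAutomorphy_GL2_potCrystallineOrdinary) :
    OrdinaryPotentialAutomorphy 0 := by
  intro F _ _ hF p _ ρ k hk hirr hunr hloc hodd
  have hk2 : k = 2 := hk
  subst hk2
  obtain ⟨F', i1, i2, i3, hF', ι, hall⟩ := hT F hF p ρ hirr hunr hloc hodd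
  refine ⟨F', i1, i2, i3, hF', ι, fun hcpt => ?_⟩
  obtain ⟨π, hL, -, hS⟩ := hall hcpt
  exact ⟨π, hL, hS⟩

/-- F3 witness shape: the floor cell by `simpa` from the floor lemma. -/
example (h : Thorne2026_potentialAutomorphy_GL2_potCrystallineOrdinary) : OrdinaryPotentialAutomorphy 0 := by
  simpa using floor_zero h

end Summit.Langlands.Langlands.Cruxes.ReciprocityUpToIrreducibility.OrdinaryPotentialAutomorphyEveryWeight

end
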